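import Summits.BirchSwinnertonDyer.Rank1Residual.X10.SelfTwistPartialAgreement
import Literature.NumberTheory.EllipticCurves.KummerSelmerStructure
import HarnessLib

/-!
# Kummer-character cocycles `σ ↦ χ(σ)·P̃` of a rational `p`-torsion point: classes, injectivity, and
# their localisations at unramified / trivial places
# (route `EisensteinPrimes`, crux 3 `MazurMCOnCellB` = stmt-BirchSwinnertonDyer-19033, line `mudescent`,
# stub 4″ `stub_lambdaCountWeak_offLocus`, ALGEBRAIC half; width seat bsd-line-x2-p1-w3, D-0154 row 5)

HONEST FRAMING (cell `bsd-eis`; nothing here proves BSD or a main conjecture; 0 cells move): THEOREMS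
ONLY — no definition, no named fact, nothing asserted about any particular curve, closes nothing. FILE 1
of 3 of the «Kummer-character classes» helper for the λ-count stub: at the étale end `W₀` of a type-A
multiplicative class the curve CARRIES a rational point `P` of order `p` (`φ = 𝟙`), and for every
continuous character `χ : Γ_ℚ → ℤ/p` the crossed homomorphism `σ ↦ χ(σ)·P̃` is a global class in
`H¹(ℚ, E[p])` — Greenberg's subgroup `Im(H¹(ℚ_Σ/ℚ_∞, Φ) → H¹(ℚ_Σ/ℚ_∞, E[p]))` (LNM 1716, proof of
Prop. 5.10, the group `A`), which print analyses only under the type-B parity hypothesis («Φ ramified and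
even or unramified and odd»). The LEAD's census names the open ALGEBRAIC content of the stub as «new
algebraic generators at KUMMER primes» (classes with `λ_an > Σ_split s_ℓ`); these classes are that
generator source, and FILE 3 (`…KummerCharacterCount`) turns a certified `𝔽_p`-space of such characters
into `GeneratorCountGE` / `AlgebraicLambdaGE`. This file is the elementary part, for ANY field `K`:

* §1 `exists_cocycle_of_character` — for `χ : Γ_K →ₜ* ℤ/p` (as `Multiplicative (ZMod p)`) and a
  `Γ_K`-fixed `P̃ ∈ E[p]`, the continuous crossed homomorphism `σ ↦ χ(σ)·P̃` with values in `E[p]`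
  (stated as an existence with its values, no definition introduced);
  `character_eq_one_of_oneCocycleClass_eq_zero` — its class detects `χ`: `[σ ↦ χ(σ)·P̃] = 0 ⇒ χ = 1`,
  granted `P̃ ≠ 0` and that `E[p]/⟨P̃⟩` has no non-zero fixed vector (`hΨ`; for `K = ℚ`, `p` odd the
  quotient is `μ_p`).
* §2 (number field `K`, finite place `v`) `res_oneCocycleClass_mem_unramifiedSubgroup_of_inertia` — if
  `χ` is unramified at `v` (`χ(res τ) = 1` on `I_v = absInertia K_v`) the localisation is an UNRAMIFIED
  class (tree: `X11b.LocBridge.mem_unramifiedSubgroup_one_iff_exists`), hence Kummer at a good place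
  (`X10.SelfTwist.unramifiedSubgroup_le_kummerLocalConditionAt_of_hasGoodReductionAt`) and Selmer over
  `K_∞` at any `v ∤ p` (`Additive.…_of_mem_unramified_sup_kummer`); `res_oneCocycleClass_eq_zero_of_trivial`
  — if `χ` is trivial on `Γ_{K_v}` the localisation vanishes.

The KUMMER-place lemma (ramified `χ` allowed at a split multiplicative `v` with `p ∤ ord_v j`) is FILE 2
(`…KummerPlaceClasses`). References: [GreenbergLNM1716] §5, proof of Prop. 5.10 (held copy chunks
p0147–p0149: the subgroup `A = Im(a) ∩ Sel_E(ℚ_∞)[p]`), §2 pp. 75–76; [GreenbergVatsal2000] §2;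
[MilneADT2006] I §2; HOME/bsd-eis HANDOFF «bsd-line-x2-p1 (LEAD) FINAL» NEXT (3).
-/

set_option autoImplicit false
-- `Summit.BirchSwinnertonDyer.BirchSwinnertonDyer.…`: the summit and its single sub-problem share a name (D-0017 layout).
set_option linter.dupNamespace false

noncomputable section

open scoped Classical

open Function Field NumberField IsDedekindDomain WeierstrassCurve
  Literature.NumberTheory.EllipticCurves Literature.NumberTheory.GaloisRepresentations
  Summit.BirchSwinnertonDyer.Rank1Residual

universe u

namespace Summit.BirchSwinnertonDyer.BirchSwinnertonDyer.Theorems.EisensteinPrimesMazurMCOnCellBKummerCharacterCocycles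

/-! ## §1. The global crossed homomorphisms `σ ↦ χ(σ)·P̃` and their classes -/

section Cocycle

variable {K : Type u} [Field K] (W : WeierstrassCurve K) {p : ℕ} [hp : Fact p.Prime]

/-- **The cocycle `σ ↦ χ(σ)·P̃`.** For any field `K`, a continuous character
`χ : Γ_K →ₜ* Multiplicative (ZMod p)` and a `Γ_K`-fixed `P̃ ∈ E[p]`: the map `σ ↦ χ(σ)·P̃` (the value
`(toAdd (χ σ)).val • P̃`) is a continuous crossed homomorphism on `Γ_K` with values in the discrete
`Γ_K`-module `E[p]` (`Γ_K` fixes `P̃`, and `p·P̃ = 0` makes `k ↦ k·P̃` depend on `k mod p` only). Stated as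
an existence with its values, so that no definition is introduced. Greenberg's classes of
`Im(H¹(ℚ_Σ/ℚ_∞, Φ) → H¹(ℚ_Σ/ℚ_∞, E[p]))`, `Φ = ⟨P̃⟩`, before restriction to `ℚ_∞`.
[cite: GreenbergLNM1716, §5, proof of Prop. 5.10 (the subgroup A)] -/
theorem exists_cocycle_of_character (χ : absoluteGaloisGroup K →ₜ* Multiplicative (ZMod p))
    (Pt : geomTorsion W (p : ℤ)) (hPt : ∀ σ : absoluteGaloisGroup K, σ • Pt = Pt) :
    ∃ φ : contOneCocycles (discreteTopRep (absoluteGaloisGroup K) (geomTorsion W (p : ℤ))),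
      ∀ σ, φ.1 σ = (Multiplicative.toAdd (χ σ)).val • Pt := by
  haveI : NeZero p := ⟨hp.out.ne_zero⟩
  -- the additive character `n = toAdd ∘ χ`
  let n : absoluteGaloisGroup K → ZMod p := fun σ ↦ Multiplicative.toAdd (χ σ)
  have hn_cont : Continuous n := continuous_toAdd.comp χ.continuous
  have hn_mul : ∀ g h, n (g * h) = n g + n h := fun g h ↦ by
    simp only [n, map_mul, toAdd_mul]
  have hpPt : p • Pt = 0 := Subtype.ext (by
    rw [AddSubgroupClass.coe_nsmul, ZeroMemClass.coe_zero]
    exact AddSubgroup.torsionBy.nsmul_iff.mp Pt.2)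
  have key : ∀ m : ℕ, (m % p) • Pt = m • Pt := fun m ↦ (nsmul_eq_mod_nsmul m hpPt).symm
  have hval : ∀ a b : ZMod p, (a + b).val • Pt = a.val • Pt + b.val • Pt := fun a b ↦ by
    rw [ZMod.val_add, key, add_nsmul]
  refine ⟨⟨⟨fun σ ↦ (n σ).val • Pt,
    (continuous_of_discreteTopology (f := fun x : ZMod p ↦ x.val • Pt)).comp hn_cont⟩,
    fun g h ↦ ?_⟩, fun σ ↦ rfl⟩
  change (n (g * h)).val • Pt = (n g).val • Pt + g • ((n h).val • Pt)
  rw [smul_comm, hPt, hn_mul, hval]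


/-- The classes `[σ ↦ χ(σ)·P̃]` detect `χ`: if `[σ ↦ χ(σ)·P̃] = 0` in `H¹(K, E[p])`, `P̃ ≠ 0`, and the
quotient `E[p]/⟨P̃⟩` has no non-zero `Γ_K`-fixed vector (`hΨ`: every `Q` with `σQ − Q ∈ ℤ·P̃` for
all `σ` lies in `ℤ·P̃`; for a rational point of odd prime order `p` over `ℚ` the quotient is `μ_p`),
then `χ = 1`: a splitting `χ(σ)·P̃ = σQ − Q` makes `Q̄` fixed, so `Q ∈ ℤ·P̃` and `χ(σ)·P̃ = 0`.
[folklore] -/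
theorem character_eq_one_of_oneCocycleClass_eq_zero
    (χ : absoluteGaloisGroup K →ₜ* Multiplicative (ZMod p))
    (Pt : geomTorsion W (p : ℤ)) (hPt : ∀ σ : absoluteGaloisGroup K, σ • Pt = Pt) (hPt0 : Pt ≠ 0)
    (hΨ : ∀ Q : geomTorsion W (p : ℤ),
      (∀ σ : absoluteGaloisGroup K, σ • Q - Q ∈ AddSubgroup.zmultiples Pt) →
        Q ∈ AddSubgroup.zmultiples Pt)
    (φ : contOneCocycles (discreteTopRep (absoluteGaloisGroup K) (geomTorsion W (p : ℤ))))
    (hφ : ∀ σ, φ.1 σ = (Multiplicative.toAdd (χ σ)).val • Pt)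
    (h0 : oneCocycleClass (discreteTopRep (absoluteGaloisGroup K) (geomTorsion W (p : ℤ))) φ = 0) :
    χ = 1 := by
  haveI : NeZero p := ⟨hp.out.ne_zero⟩
  obtain ⟨Q, hQ⟩ := (oneCocycleClass_eq_zero_iff _ _).mp h0
  have hQ' : ∀ σ : absoluteGaloisGroup K, σ • Q - Q = (Multiplicative.toAdd (χ σ)).val • Pt :=
    fun σ ↦ by rw [← hφ σ, hQ σ]; rfl
  have hQmem : Q ∈ AddSubgroup.zmultiples Pt := hΨ Q fun σ ↦ by
    rw [hQ']
    exact AddSubgroup.nsmul_mem _ (AddSubgroup.mem_zmultiples Pt) _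
  obtain ⟨m, rfl⟩ := AddSubgroup.mem_zmultiples_iff.mp hQmem
  have hpPt : p • Pt = 0 := Subtype.ext (by
    rw [AddSubgroupClass.coe_nsmul, ZeroMemClass.coe_zero]
    exact AddSubgroup.torsionBy.nsmul_iff.mp Pt.2)
  have hord : addOrderOf Pt = p := addOrderOf_eq_prime hpPt hPt0
  ext σ
  have h1 : (Multiplicative.toAdd (χ σ)).val • Pt = 0 := by
    rw [← hQ' σ, smul_comm, hPt, sub_self]
  have hdvd : p ∣ (Multiplicative.toAdd (χ σ)).val := by
    have h := (addOrderOf_dvd_iff_nsmul_eq_zero (x := Pt)).mpr h1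
    rwa [hord] at h
  have hval : (Multiplicative.toAdd (χ σ)).val = 0 :=
    Nat.eq_zero_of_dvd_of_lt hdvd (ZMod.val_lt _)
  rw [ZMod.val_eq_zero] at hval
  change χ σ = 1
  exact toAdd_eq_zero.mp hval

end Cocycle


/-! ## §2. Localisations at a place where `χ` is unramified, or trivial -/

section Local

variable {K : Type} [Field K] [NumberField K] (W : WeierstrassCurve K) {p : ℕ}
  [hp : Fact p.Prime] (v : HeightOneSpectrum (𝓞 K))

/-- **At a place where `χ_v` is unramified the localisation of `[σ ↦ χ(σ)·P̃]` is an unramified class**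
(`P̃` being `Γ_K`-fixed, the cocycle vanishes identically on the inertia group `I_v`; tree:
`LocBridge.mem_unramifiedSubgroup_one_iff_exists`). [cite: MilneADT2006, Ch. I §2 (unramified cohomology)] -/
theorem res_oneCocycleClass_mem_unramifiedSubgroup_of_inertia
    (Pt : geomTorsion W (p : ℤ))
    (χv : absoluteGaloisGroup (v.adicCompletion K) →ₜ* Multiplicative (ZMod p))
    (hχv : ∀ τ ∈ absInertia (v.adicCompletion K), χv τ = 1)
    (φ : contOneCocycles (discreteTopRep (absoluteGaloisGroup K) (geomTorsion W (p : ℤ))))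
    (hφ : ∀ σ : absoluteGaloisGroup (v.adicCompletion K),
      φ.1 (resGal (K := K) (v.adicCompletion K) σ) = (Multiplicative.toAdd (χv σ)).val • Pt) :
    galoisCohomology.res (W.torsionGaloisModule (p : ℤ)) (v.adicCompletion K) 1
        (oneCocycleClass (discreteTopRep (absoluteGaloisGroup K) (geomTorsion W (p : ℤ))) φ) ∈
      DiscreteGaloisModule.unramifiedSubgroup
        ((W.torsionGaloisModule (p : ℤ)).restrictField (v.adicCompletion K)) 1 := by
  rw [WeierstrassCurve.res_torsionGaloisModule_oneCocycleClass]
  refine (X11b.LocBridge.mem_unramifiedSubgroup_one_iff_exists _ _).mpr ⟨0, fun τ hτ ↦ ?_⟩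
  rw [contOneCocycles.pullback_apply, map_zero, sub_zero]
  change φ.1 (resGal (K := K) (v.adicCompletion K) τ) = 0
  rw [hφ, hχv τ hτ, toAdd_one, ZMod.val_zero, zero_smul]

/-- **At a place where `χ_v` is trivial the localisation of `[σ ↦ χ(σ)·P̃]` vanishes.** [folklore] -/
theorem res_oneCocycleClass_eq_zero_of_trivial
    (Pt : geomTorsion W (p : ℤ))
    (χv : absoluteGaloisGroup (v.adicCompletion K) →ₜ* Multiplicative (ZMod p))
    (hχv : ∀ τ : absoluteGaloisGroup (v.adicCompletion K), χv τ = 1)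
    (φ : contOneCocycles (discreteTopRep (absoluteGaloisGroup K) (geomTorsion W (p : ℤ))))
    (hφ : ∀ σ : absoluteGaloisGroup (v.adicCompletion K),
      φ.1 (resGal (K := K) (v.adicCompletion K) σ) = (Multiplicative.toAdd (χv σ)).val • Pt) :
    galoisCohomology.res (W.torsionGaloisModule (p : ℤ)) (v.adicCompletion K) 1
        (oneCocycleClass (discreteTopRep (absoluteGaloisGroup K) (geomTorsion W (p : ℤ))) φ) = 0 := by
  rw [WeierstrassCurve.res_torsionGaloisModule_oneCocycleClass]
  refine (oneCocycleClass_eq_zero_iff _ _).mpr ⟨0, fun τ ↦ ?_⟩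
  rw [contOneCocycles.pullback_apply, map_zero, sub_zero]
  change φ.1 (resGal (K := K) (v.adicCompletion K) τ) = 0
  rw [hφ, hχv τ, toAdd_one, ZMod.val_zero, zero_smul]


end Local

end Summit.BirchSwinnertonDyer.BirchSwinnertonDyer.Theorems.EisensteinPrimesMazurMCOnCellBKummerCharacterCocycles

end
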